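import Literature.Topology.FourManifolds.MMSWFibreRotation
import Summits.SmoothPoincare4.SmoothPoincare4.Theorems.DottedCircleRasmussenDcrGapHelperHandlebodyChartModelHandlesBaseBall

/-!
# Helper `helper_handlebodyChart_modelHandles` (M3: handle structure of the model dotted handlebody `D_k`)
# of line `mk_friends` for crux `DcrGap` — handle charts, part 4: the polar chart in `ℝ⁴ = ℂ²`
(item stmt-SmoothPoincare4-16128, route route-SmoothPoincare4-DottedCircleRasmussen)

Towards the registered stub `helper_handlebodyChart_modelHandles_data_part1`.  A handle chart is the polar map
`h(p) = (z₀ + r s d e(m), r w̃)` of `ℝ⁴ = ℂ²` about the base centre `c = (z₀, 0)`, where `(r, m)` is the value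
of the planar tube map at `(p₀, p₁)`, `w̃ = (p₂ + i p₃)/N`, `s = √(1 - |w̃|²)`, `d` is the unit direction of
the hole and `e(m) = (V + i m)/√(V² + m²)` the unit vector with lateral slope `m/V`.  For an abstract chart
`h` given by these two formulas (`zC ∘ h`, `wC ∘ h`) this file proves:

* `ModelHandles.dir_props`: `e` is unit, smooth, injective, with `Re e > 0` and `V Im e / Re e = m`;
* `ModelHandles.chart_dist`: `‖h p - c‖ = r` (the chart is conical about `c`);
* `ModelHandles.chart_equivariant`: rotating `(p₂, p₃)` is the fibre rotation of the `w`-plane;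
* `ModelHandles.chart_contDiffOn`, `ModelHandles.chart_injOn`, `ModelHandles.chart_fderiv_injective`:
  `h` is smooth, injective and immersive on `W` as soon as the planar tube map is (the immersivity through the
  smooth left inverse `y ↦ (‖y - c‖, V Im q/Re q, N Re w/‖y - c‖, N Im w/‖y - c‖)`, `q = (z - z₀) d̄`).

Registered summary `helper_handlebodyChart_modelHandles_polarChart`.  No definitions, no named facts,
no `sorry`.  References: R. Kirby, *The Topology of 4-Manifolds*, LNM 1374 (1989), Ch. I §2 [Kirby1989].
-/

-- the prescribed namespace `Summit.<P>.<Sub>.…` duplicates `SmoothPoincare4` (P = Sub)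
set_option linter.dupNamespace false
set_option linter.style.longLine false
noncomputable section

open scoped Manifold ContDiff Topology ComplexConjugate
open Function Set Metric Filter
open Literature.Topology.FourManifolds Literature.Topology.FourManifolds.MMSW
open Literature.AlgebraicTopology.Homotopy.HopfFibration

namespace Summit.SmoothPoincare4.SmoothPoincare4.Theorems.DcrGap.MkFriends

namespace ModelHandles

/-! ## Coordinates and derivatives -/

/-- `z` and `w` are additive: `z(x - y) = z(x) - z(y)`, `w(x - y) = w(x) - w(y)`. [folklore] -/
theorem zC_sub_wC_sub (x y : (EuclideanSpace ℝ (Fin 4))) : zC (x - y) = zC x - zC y ∧ wC (x - y) = wC x - wC y :=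
  ⟨Complex.ext rfl rfl, Complex.ext rfl rfl⟩

/-- Coordinates of a derivative: `(Df(p) v)_i = D(f_i)(p) v`. [folklore] -/
theorem fderiv_apply_coord {f : (EuclideanSpace ℝ (Fin 4)) → (EuclideanSpace ℝ (Fin 4))} {p : (EuclideanSpace ℝ (Fin 4))} (hf : DifferentiableAt ℝ f p) (v : (EuclideanSpace ℝ (Fin 4))) (i : Fin 4) :
    (fderiv ℝ f p v) i = fderiv ℝ (fun x => f x i) p v := by
  have h := ((EuclideanSpace.proj (𝕜 := ℝ) i).hasFDerivAt.comp p hf.hasFDerivAt).fderiv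
  have e : (fun x => f x i) = (EuclideanSpace.proj (𝕜 := ℝ) i) ∘ f := by funext x; simp
  rw [e, h]; simp

/-- The derivative of a coordinate: `D(x ↦ x_i)(p) v = v_i`. [folklore] -/
theorem fderiv_coord (i : Fin 4) (p v : (EuclideanSpace ℝ (Fin 4))) : fderiv ℝ (fun x : (EuclideanSpace ℝ (Fin 4)) => x i) p v = v i := by
  have : (fun x : (EuclideanSpace ℝ (Fin 4)) => x i) = EuclideanSpace.proj (𝕜 := ℝ) i := by funext x; simp
  rw [this, ContinuousLinearMap.fderiv]; simp

/-! ## The direction vector `e(m) = (V + i m)/√(V² + m²)` -/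

/-- **The unit direction with lateral slope `m/V`**: `e(m) = (V + i m)/√(V² + m²)` (`V > 0`) is a unit complex
number with positive real part `V/√(V² + m²)`, imaginary part `m/√(V² + m²)`, `V Im e/Re e = m`; it is smooth and
injective in `m`. [folklore] -/
theorem dir_props {V : ℝ} (hV : 0 < V) (e : ℝ → ℂ)
    (hE : ∀ m, e m = ((V : ℂ) + (m : ℂ) * Complex.I) * (((Real.sqrt (V ^ 2 + m ^ 2))⁻¹ : ℝ) : ℂ)) :
    (∀ m, ‖e m‖ = 1) ∧ (∀ m, (e m).re = V / Real.sqrt (V ^ 2 + m ^ 2) ∧ (e m).im = m / Real.sqrt (V ^ 2 + m ^ 2)) ∧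
    (∀ m, 0 < (e m).re) ∧ (∀ m, V * (e m).im / (e m).re = m) ∧ ContDiff ℝ ∞ e ∧ Injective e := by
  have hσ : ∀ m : ℝ, 0 < Real.sqrt (V ^ 2 + m ^ 2) := fun m => Real.sqrt_pos.2 (by positivity)
  have hreim : ∀ m, (e m).re = V / Real.sqrt (V ^ 2 + m ^ 2) ∧ (e m).im = m / Real.sqrt (V ^ 2 + m ^ 2) := by
    intro m
    rw [hE, Complex.re_mul_ofReal, Complex.im_mul_ofReal]
    constructor
    · simp [div_eq_mul_inv]
    · simp [div_eq_mul_inv]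
  have hre : ∀ m, 0 < (e m).re := fun m => by rw [(hreim m).1]; exact div_pos hV (hσ m)
  have hratio : ∀ m, V * (e m).im / (e m).re = m := fun m => by
    rw [(hreim m).1, (hreim m).2]
    field_simp
  refine ⟨fun m => ?_, hreim, hre, hratio, ?_, fun m m' h => ?_⟩
  · rw [hE, norm_mul, Complex.norm_real, Real.norm_eq_abs, abs_inv, abs_of_pos (hσ m)]
    have : ‖(V : ℂ) + (m : ℂ) * Complex.I‖ = Real.sqrt (V ^ 2 + m ^ 2) := Complex.norm_add_mul_I V m
    rw [this, mul_inv_cancel₀ (hσ m).ne']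
  · have heq : e = fun m : ℝ => ((V : ℂ) + (m : ℂ) * Complex.I) * (((Real.sqrt (V ^ 2 + m ^ 2))⁻¹ : ℝ) : ℂ) :=
      funext hE
    rw [heq]
    refine ((contDiff_const.add ((Complex.ofRealCLM.contDiff.comp contDiff_id).mul contDiff_const)).mul
      (Complex.ofRealCLM.contDiff.comp ?_))
    refine ContDiff.inv ?_ fun m => (hσ m).ne'
    have h1 : ContDiff ℝ ∞ (fun m : ℝ => V ^ 2 + m ^ 2) := by fun_prop
    exact h1.sqrt fun m => by positivity
  · have := hratio m
    rw [h, hratio m'] at this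
    exact this.symm

/-! ## The polar chart: distance from the centre and equivariance -/

/-- `|w̃|² = (p₂² + p₃²)/N²` bookkeeping: `s² + |w̃|² = 1` for `s = √(1 - (p₂² + p₃²)/N²)` when
`p₂² + p₃² ≤ N²`. [folklore] -/
theorem sw_sq {N a b : ℝ} (hN : 0 < N) (hab : a ^ 2 + b ^ 2 ≤ N ^ 2) :
    Real.sqrt (1 - (a ^ 2 + b ^ 2) / N ^ 2) ^ 2 + (a ^ 2 + b ^ 2) / N ^ 2 = 1 := by
  have h0 : 0 ≤ 1 - (a ^ 2 + b ^ 2) / N ^ 2 := by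
    rw [sub_nonneg, div_le_one (by positivity)]; exact hab
  rw [Real.sq_sqrt h0]; ring

/-- **The chart is conical about the centre**: `‖h p - (z₀, 0)‖ = r(p)` whenever `r(p) ≥ 0` and
`p₂² + p₃² ≤ N²` (`|d| = |e| = 1`). [folklore] -/
theorem chart_dist {h : (EuclideanSpace ℝ (Fin 4)) → (EuclideanSpace ℝ (Fin 4))} {fr fm : ℝ → ℝ → ℝ} {z₀ d : ℂ} {N : ℝ} {e : ℝ → ℂ}
    (hd : ‖d‖ = 1) (he : ∀ m, ‖e m‖ = 1) (hN : 0 < N)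
    (hz : ∀ p, zC (h p) = z₀ + ((fr (p 0) (p 1) * Real.sqrt (1 - ((p 2) ^ 2 + (p 3) ^ 2) / N ^ 2) : ℝ) : ℂ) * d * e (fm (p 0) (p 1)))
    (hw : ∀ p, wC (h p) = ((fr (p 0) (p 1) / N : ℝ) : ℂ) * ((p 2 : ℂ) + (p 3 : ℂ) * Complex.I))
    {p : (EuclideanSpace ℝ (Fin 4))} (hr : 0 ≤ fr (p 0) (p 1)) (hp : (p 2) ^ 2 + (p 3) ^ 2 ≤ N ^ 2) :
    ‖h p - ofZW z₀ 0‖ = fr (p 0) (p 1) := by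
  have hsq := normSq_zC_sub_add (h p) (ofZW z₀ 0)
  rw [zC_ofZW, wC_ofZW, sub_zero] at hsq
  have h0 : 0 ≤ 1 - ((p 2) ^ 2 + (p 3) ^ 2) / N ^ 2 := by
    rw [sub_nonneg, div_le_one (by positivity)]; exact hp
  have hzn : Complex.normSq (zC (h p) - z₀) = fr (p 0) (p 1) ^ 2 * (1 - ((p 2) ^ 2 + (p 3) ^ 2) / N ^ 2) := by
    rw [hz, add_sub_cancel_left, Complex.normSq_eq_norm_sq, norm_mul, norm_mul, hd, he, mul_one, mul_one,
      Complex.norm_real, Real.norm_eq_abs, sq_abs, mul_pow, Real.sq_sqrt h0]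
  have hwn : Complex.normSq (wC (h p)) = (fr (p 0) (p 1) / N) ^ 2 * ((p 2) ^ 2 + (p 3) ^ 2) := by
    rw [hw, Complex.normSq_eq_norm_sq, norm_mul, Complex.norm_real, Real.norm_eq_abs, Complex.norm_add_mul_I,
      mul_pow, sq_abs, Real.sq_sqrt (by positivity)]
  have h2 : ‖h p - ofZW z₀ 0‖ ^ 2 = fr (p 0) (p 1) ^ 2 := by
    rw [← hsq, hzn, hwn]
    field_simp
    ring
  exact (sq_eq_sq₀ (norm_nonneg _) hr).1 h2

/-- **Equivariance of the chart**: rotating the `(p₂, p₃)`-plane by `β` is the fibre rotation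
`(z, w) ↦ (z, e^{iβ} w)` of the image. [folklore] -/
theorem chart_equivariant {h : (EuclideanSpace ℝ (Fin 4)) → (EuclideanSpace ℝ (Fin 4))} {fr fm : ℝ → ℝ → ℝ} {z₀ d : ℂ} {N : ℝ} {e : ℝ → ℂ}
    (hz : ∀ p, zC (h p) = z₀ + ((fr (p 0) (p 1) * Real.sqrt (1 - ((p 2) ^ 2 + (p 3) ^ 2) / N ^ 2) : ℝ) : ℂ) * d * e (fm (p 0) (p 1)))
    (hw : ∀ p, wC (h p) = ((fr (p 0) (p 1) / N : ℝ) : ℂ) * ((p 2 : ℂ) + (p 3 : ℂ) * Complex.I))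
    (β : ℝ) (p : (EuclideanSpace ℝ (Fin 4))) :
    h (!₂[p 0, p 1, Real.cos β * p 2 - Real.sin β * p 3, Real.sin β * p 2 + Real.cos β * p 3]) =
      fibreRot (fun _ => Complex.exp ((β : ℂ) * Complex.I)) (h p) := by
  rw [fibreRot, ← ofZW_zC_wC (h (!₂[p 0, p 1, Real.cos β * p 2 - Real.sin β * p 3, Real.sin β * p 2 + Real.cos β * p 3])),
    hz, hw, hz, hw]
  have hrot : (Real.cos β * p 2 - Real.sin β * p 3) ^ 2 + (Real.sin β * p 2 + Real.cos β * p 3) ^ 2 =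
      (p 2) ^ 2 + (p 3) ^ 2 := by nlinarith [Real.cos_sq_add_sin_sq β]
  congr 1
  · simp [hrot]
  · simp only [Matrix.cons_val_zero, Matrix.cons_val_one, Matrix.cons_val]
    rw [Complex.exp_mul_I, ← Complex.ofReal_cos, ← Complex.ofReal_sin]
    apply Complex.ext
    · simp only [Complex.mul_re, Complex.mul_im, Complex.add_re, Complex.add_im, Complex.ofReal_re,
        Complex.ofReal_im, Complex.I_re, Complex.I_im]
      ring
    · simp only [Complex.mul_re, Complex.mul_im, Complex.add_re, Complex.add_im, Complex.ofReal_re,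
        Complex.ofReal_im, Complex.I_re, Complex.I_im]
      ring

/-! ## Smoothness -/

/-- **The chart is smooth** on any `W` on which the planar components are smooth and `p₂² + p₃² < N²`.
[folklore] -/
theorem chart_contDiffOn {h : (EuclideanSpace ℝ (Fin 4)) → (EuclideanSpace ℝ (Fin 4))} {fr fm : ℝ → ℝ → ℝ} {z₀ d : ℂ} {N : ℝ} {e : ℝ → ℂ} {W : Set (EuclideanSpace ℝ (Fin 4))}
    (hes : ContDiff ℝ ∞ e) (hN : 0 < N)
    (hz : ∀ p, zC (h p) = z₀ + ((fr (p 0) (p 1) * Real.sqrt (1 - ((p 2) ^ 2 + (p 3) ^ 2) / N ^ 2) : ℝ) : ℂ) * d * e (fm (p 0) (p 1)))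
    (hw : ∀ p, wC (h p) = ((fr (p 0) (p 1) / N : ℝ) : ℂ) * ((p 2 : ℂ) + (p 3 : ℂ) * Complex.I))
    (hfr : ContDiffOn ℝ ∞ (fun p : (EuclideanSpace ℝ (Fin 4)) => fr (p 0) (p 1)) W) (hfm : ContDiffOn ℝ ∞ (fun p : (EuclideanSpace ℝ (Fin 4)) => fm (p 0) (p 1)) W)
    (hWN : ∀ p ∈ W, (p 2) ^ 2 + (p 3) ^ 2 < N ^ 2) : ContDiffOn ℝ ∞ h W := by
  have hsw : ContDiffOn ℝ ∞ (fun p : (EuclideanSpace ℝ (Fin 4)) => Real.sqrt (1 - ((p 2) ^ 2 + (p 3) ^ 2) / N ^ 2)) W := by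
    refine ContDiffOn.sqrt (by fun_prop) fun p hp => ?_
    have := hWN p hp
    have : ((p 2) ^ 2 + (p 3) ^ 2) / N ^ 2 < 1 := by rw [div_lt_one (by positivity)]; exact this
    linarith
  have hZ : ContDiffOn ℝ ∞ (fun p => zC (h p)) W := by
    have heq : (fun p => zC (h p)) = fun p => z₀ + ((fr (p 0) (p 1) * Real.sqrt (1 - ((p 2) ^ 2 + (p 3) ^ 2) / N ^ 2) : ℝ) : ℂ) * d * e (fm (p 0) (p 1)) :=
      funext hz
    rw [heq]
    exact contDiffOn_const.add (((Complex.ofRealCLM.contDiff.comp_contDiffOn (hfr.mul hsw)).mul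
      contDiffOn_const).mul (hes.comp_contDiffOn hfm))
  have hWc : ContDiffOn ℝ ∞ (fun p => wC (h p)) W := by
    have heq : (fun p => wC (h p)) = fun p => ((fr (p 0) (p 1) / N : ℝ) : ℂ) * ((p 2 : ℂ) + (p 3 : ℂ) * Complex.I) :=
      funext hw
    rw [heq]
    refine (Complex.ofRealCLM.contDiff.comp_contDiffOn (hfr.div_const _)).mul ?_
    exact ((Complex.ofRealCLM.contDiff.comp (by fun_prop)).add
      ((Complex.ofRealCLM.contDiff.comp (by fun_prop)).mul contDiff_const)).contDiffOn
  rw [contDiffOn_euclidean]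
  intro i
  fin_cases i
  · exact Complex.reCLM.contDiff.comp_contDiffOn hZ
  · exact Complex.imCLM.contDiff.comp_contDiffOn hZ
  · exact Complex.reCLM.contDiff.comp_contDiffOn hWc
  · exact Complex.imCLM.contDiff.comp_contDiffOn hWc

/-! ## Injectivity -/

/-- **The chart is injective** on any `W` on which the planar tube map is injective, `r > 0` and
`p₂² + p₃² < N²`. [folklore] -/
theorem chart_injOn {h : (EuclideanSpace ℝ (Fin 4)) → (EuclideanSpace ℝ (Fin 4))} {fr fm : ℝ → ℝ → ℝ} {z₀ d : ℂ} {N : ℝ} {e : ℝ → ℂ} {W : Set (EuclideanSpace ℝ (Fin 4))}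
    (hd : ‖d‖ = 1) (he : ∀ m, ‖e m‖ = 1) (heinj : Injective e) (hN : 0 < N)
    (hz : ∀ p, zC (h p) = z₀ + ((fr (p 0) (p 1) * Real.sqrt (1 - ((p 2) ^ 2 + (p 3) ^ 2) / N ^ 2) : ℝ) : ℂ) * d * e (fm (p 0) (p 1)))
    (hw : ∀ p, wC (h p) = ((fr (p 0) (p 1) / N : ℝ) : ℂ) * ((p 2 : ℂ) + (p 3 : ℂ) * Complex.I))
    (hinj : ∀ p ∈ W, ∀ q ∈ W, fr (p 0) (p 1) = fr (q 0) (q 1) → fm (p 0) (p 1) = fm (q 0) (q 1) → p 0 = q 0 ∧ p 1 = q 1)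
    (hpos : ∀ p ∈ W, 0 < fr (p 0) (p 1)) (hWN : ∀ p ∈ W, (p 2) ^ 2 + (p 3) ^ 2 < N ^ 2) : InjOn h W := by
  intro p hp q hq hpq
  have hd0 : d ≠ 0 := by intro h0; rw [h0, norm_zero] at hd; exact zero_ne_one hd
  -- the radii agree
  have hr : fr (p 0) (p 1) = fr (q 0) (q 1) := by
    rw [← chart_dist hd he hN hz hw (hpos p hp).le (hWN p hp).le,
      ← chart_dist hd he hN hz hw (hpos q hq).le (hWN q hq).le, hpq]
  have hr0 := hpos p hp
  -- the `w`-coordinates agree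
  have hw' : wC (h p) = wC (h q) := by rw [hpq]
  rw [hw, hw, ← hr] at hw'
  have hrN : ((fr (p 0) (p 1) / N : ℝ) : ℂ) ≠ 0 := by
    exact_mod_cast (div_pos hr0 hN).ne'
  have hw2 := mul_left_cancel₀ hrN hw'
  have h2 : p 2 = q 2 := by have := congrArg Complex.re hw2; simpa using this
  have h3 : p 3 = q 3 := by have := congrArg Complex.im hw2; simpa using this
  -- the `z`-coordinates agree
  have hz' : zC (h p) = zC (h q) := by rw [hpq]
  rw [hz, hz, ← hr, ← h2, ← h3, add_right_inj] at hz'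
  have hsw : 0 < Real.sqrt (1 - ((p 2) ^ 2 + (p 3) ^ 2) / N ^ 2) := by
    apply Real.sqrt_pos.2
    have : ((p 2) ^ 2 + (p 3) ^ 2) / N ^ 2 < 1 := by rw [div_lt_one (by positivity)]; exact hWN p hp
    linarith
  have hc0 : ((fr (p 0) (p 1) * Real.sqrt (1 - ((p 2) ^ 2 + (p 3) ^ 2) / N ^ 2) : ℝ) : ℂ) * d ≠ 0 := by
    refine mul_ne_zero ?_ hd0
    exact_mod_cast (mul_pos hr0 hsw).ne'
  have hm : fm (p 0) (p 1) = fm (q 0) (q 1) := heinj (mul_left_cancel₀ hc0 hz')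
  obtain ⟨h0, h1⟩ := hinj p hp q hq hr hm
  ext i
  fin_cases i
  · exact h0
  · exact h1
  · exact h2
  · exact h3

/-! ## Immersivity: the smooth left inverse -/

/-- **The chart is immersive**: at `p ∈ W` (`W` open, planar components smooth with trivial Jacobian kernel,
`r > 0`, `p₂² + p₃² < N²`) the derivative `Dh(p)` is injective — the smooth map
`Ψ(y) = (‖y - c‖, V Im q/Re q, N Re w/‖y - c‖, N Im w/‖y - c‖)` (`q = (z - z₀) d̄`) satisfies
`Ψ ∘ h = (r, m, p₂, p₃)` on `W`. [folklore] -/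
theorem chart_fderiv_injective {h : (EuclideanSpace ℝ (Fin 4)) → (EuclideanSpace ℝ (Fin 4))} {fr fm : ℝ → ℝ → ℝ} {z₀ d : ℂ} {N V : ℝ} {e : ℝ → ℂ} {W : Set (EuclideanSpace ℝ (Fin 4))}
    (hd : ‖d‖ = 1) (he : ∀ m, ‖e m‖ = 1) (here : ∀ m, 0 < (e m).re)
    (hratio : ∀ m, V * (e m).im / (e m).re = m) (hes : ContDiff ℝ ∞ e) (hN : 0 < N) (hWo : IsOpen W)
    (hz : ∀ p, zC (h p) = z₀ + ((fr (p 0) (p 1) * Real.sqrt (1 - ((p 2) ^ 2 + (p 3) ^ 2) / N ^ 2) : ℝ) : ℂ) * d * e (fm (p 0) (p 1)))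
    (hw : ∀ p, wC (h p) = ((fr (p 0) (p 1) / N : ℝ) : ℂ) * ((p 2 : ℂ) + (p 3 : ℂ) * Complex.I))
    (hfr : ContDiffOn ℝ ∞ (fun p : (EuclideanSpace ℝ (Fin 4)) => fr (p 0) (p 1)) W) (hfm : ContDiffOn ℝ ∞ (fun p : (EuclideanSpace ℝ (Fin 4)) => fm (p 0) (p 1)) W)
    (hpos : ∀ p ∈ W, 0 < fr (p 0) (p 1)) (hWN : ∀ p ∈ W, (p 2) ^ 2 + (p 3) ^ 2 < N ^ 2)
    {p : (EuclideanSpace ℝ (Fin 4))} (hp : p ∈ W)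
    (hker : ∀ v : (EuclideanSpace ℝ (Fin 4)), fderiv ℝ (fun p : (EuclideanSpace ℝ (Fin 4)) => fr (p 0) (p 1)) p v = 0 → fderiv ℝ (fun p : (EuclideanSpace ℝ (Fin 4)) => fm (p 0) (p 1)) p v = 0 →
      v 0 = 0 ∧ v 1 = 0) :
    Injective (fderiv ℝ h p) := by
  have hd0 : d ≠ 0 := by intro h0; rw [h0, norm_zero] at hd; exact zero_ne_one hd
  have hdd : d * conj d = 1 := by
    rw [Complex.mul_conj, Complex.normSq_eq_norm_sq, hd]; norm_num
  set c : (EuclideanSpace ℝ (Fin 4)) := ofZW z₀ 0 with hc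
  -- the left inverse
  set Ψ : (EuclideanSpace ℝ (Fin 4)) → (EuclideanSpace ℝ (Fin 4)) := fun y => !₂[‖y - c‖, V * ((zC y - z₀) * conj d).im / ((zC y - z₀) * conj d).re,
    N * (wC y).re / ‖y - c‖, N * (wC y).im / ‖y - c‖] with hΨ
  set F : (EuclideanSpace ℝ (Fin 4)) → (EuclideanSpace ℝ (Fin 4)) := fun p => !₂[fr (p 0) (p 1), fm (p 0) (p 1), p 2, p 3] with hF
  -- values of the ingredients of `Ψ` on the chart
  have hsw : ∀ p ∈ W, 0 < Real.sqrt (1 - ((p 2) ^ 2 + (p 3) ^ 2) / N ^ 2) := fun p hp => by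
    apply Real.sqrt_pos.2
    have : ((p 2) ^ 2 + (p 3) ^ 2) / N ^ 2 < 1 := by rw [div_lt_one (by positivity)]; exact hWN p hp
    linarith
  have hq : ∀ p, (zC (h p) - z₀) * conj d =
      ((fr (p 0) (p 1) * Real.sqrt (1 - ((p 2) ^ 2 + (p 3) ^ 2) / N ^ 2) : ℝ) : ℂ) * e (fm (p 0) (p 1)) := by
    intro p; rw [hz]; linear_combination (((fr (p 0) (p 1) * Real.sqrt (1 - ((p 2) ^ 2 + (p 3) ^ 2) / N ^ 2) : ℝ) : ℂ) * e (fm (p 0) (p 1))) * hdd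
  have hqre : ∀ p ∈ W, 0 < ((zC (h p) - z₀) * conj d).re := fun p hp => by
    rw [hq, Complex.re_ofReal_mul]; exact mul_pos (mul_pos (hpos p hp) (hsw p hp)) (here _)
  have hdist : ∀ p ∈ W, ‖h p - c‖ = fr (p 0) (p 1) := fun p hp =>
    chart_dist hd he hN hz hw (hpos p hp).le (hWN p hp).le
  -- `Ψ ∘ h = F` on `W`
  have hcomp : ∀ p ∈ W, Ψ (h p) = F p := by
    intro p hp
    have hr0 := hpos p hp
    simp only [hΨ, hF, hdist p hp]
    congr 1
    funext i
    fin_cases i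
    · rfl
    · simp only [Fin.mk_one, Matrix.cons_val_one, Matrix.cons_val_zero]
      have hne : (fr (p 0) (p 1) * Real.sqrt (1 - ((p 2) ^ 2 + (p 3) ^ 2) / N ^ 2)) ≠ 0 :=
        (mul_pos hr0 (hsw p hp)).ne'
      rw [hq, Complex.re_ofReal_mul, Complex.im_ofReal_mul, mul_left_comm, mul_div_mul_left _ _ hne]
      exact hratio _
    · simp only [Fin.reduceFinMk, Matrix.cons_val]
      rw [hw, Complex.re_ofReal_mul]; simp; field_simp
    · simp only [Fin.reduceFinMk, Matrix.cons_val]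
      rw [hw, Complex.im_ofReal_mul]; simp; field_simp
  -- differentiability of `Ψ` at `h p`, of `h` and `F` at `p`
  have hy0 : h p - c ≠ 0 := by
    rw [← norm_ne_zero_iff, hdist p hp]; exact (hpos p hp).ne'
  have hΨd : DifferentiableAt ℝ Ψ (h p) := by
    have hn : ContDiffAt ℝ ∞ (fun y : (EuclideanSpace ℝ (Fin 4)) => ‖y - c‖) (h p) :=
      (contDiffAt_norm ℝ hy0).comp (h p) (contDiffAt_id.sub contDiffAt_const)
    have hqd : ContDiffAt ℝ ∞ (fun y : (EuclideanSpace ℝ (Fin 4)) => (zC y - z₀) * conj d) (h p) :=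
      ((contDiff_zC.contDiffAt).sub contDiffAt_const).mul contDiffAt_const
    have hne1 : ‖h p - c‖ ≠ 0 := norm_ne_zero_iff.2 hy0
    have hne2 : ((zC (h p) - z₀) * conj d).re ≠ 0 := (hqre p hp).ne'
    rw [hΨ, differentiableAt_euclidean]
    intro i
    fin_cases i
    · simpa using hn.differentiableAt (by simp)
    · simp only [Fin.mk_one, Matrix.cons_val_one, Matrix.cons_val_zero]
      exact ((contDiffAt_const.mul (Complex.imCLM.contDiff.contDiffAt.comp _ hqd)).div
        (Complex.reCLM.contDiff.contDiffAt.comp _ hqd) hne2).differentiableAt (by simp)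
    · simp only [Fin.reduceFinMk, Matrix.cons_val]
      exact ((contDiffAt_const.mul (Complex.reCLM.contDiff.contDiffAt.comp _ contDiff_wC.contDiffAt)).div
        hn hne1).differentiableAt (by simp)
    · simp only [Fin.reduceFinMk, Matrix.cons_val]
      exact ((contDiffAt_const.mul (Complex.imCLM.contDiff.contDiffAt.comp _ contDiff_wC.contDiffAt)).div
        hn hne1).differentiableAt (by simp)
  have hWnhds : W ∈ 𝓝 p := hWo.mem_nhds hp
  have hhd : DifferentiableAt ℝ h p :=
    ((chart_contDiffOn hes hN hz hw hfr hfm hWN).differentiableOn (by simp)).differentiableAt hWnhds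
  have hfrd : DifferentiableAt ℝ (fun p : (EuclideanSpace ℝ (Fin 4)) => fr (p 0) (p 1)) p :=
    (hfr.differentiableOn (by simp)).differentiableAt hWnhds
  have hfmd : DifferentiableAt ℝ (fun p : (EuclideanSpace ℝ (Fin 4)) => fm (p 0) (p 1)) p :=
    (hfm.differentiableOn (by simp)).differentiableAt hWnhds
  have hFd : DifferentiableAt ℝ F p := by
    rw [hF, differentiableAt_euclidean]
    intro i
    fin_cases i
    · simpa using hfrd
    · simpa using hfmd
    · simp only [Fin.reduceFinMk, Matrix.cons_val]; fun_prop
    · simp only [Fin.reduceFinMk, Matrix.cons_val]; fun_prop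
  -- the chain rule on `Ψ ∘ h = F` near `p`
  have hev : Ψ ∘ h =ᶠ[𝓝 p] F := by
    filter_upwards [hWnhds] with q hq using hcomp q hq
  have hchain : (fderiv ℝ Ψ (h p)).comp (fderiv ℝ h p) = fderiv ℝ F p := by
    rw [← fderiv_comp p hΨd hhd]; exact hev.fderiv_eq
  -- conclusion
  intro v v' hvv
  rw [← sub_eq_zero] at hvv ⊢
  rw [← map_sub] at hvv
  set u := v - v' with hu
  have hFu : fderiv ℝ F p u = 0 := by
    rw [← hchain, ContinuousLinearMap.comp_apply, hvv, map_zero]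
  have hcoord : ∀ i, fderiv ℝ (fun x => F x i) p u = 0 := fun i => by
    rw [← fderiv_apply_coord hFd]; rw [hFu]; rfl
  have h0 := hcoord 0
  have h1 := hcoord 1
  have h2 := hcoord 2
  have h3 := hcoord 3
  simp only [hF, PiLp.toLp_apply, Matrix.cons_val_zero, Matrix.cons_val_one, Matrix.cons_val] at h0 h1 h2 h3
  rw [fderiv_coord] at h2 h3
  obtain ⟨hu0, hu1⟩ := hker u h0 h1
  ext i
  fin_cases i
  · exact hu0
  · exact hu1
  · exact h2
  · exact h3

end ModelHandles

/-- **Registered piece `helper_handlebodyChart_modelHandles_polarChart` of the data stub, part 1 (the polar chart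
in `ℝ⁴ = ℂ²`)**: the direction `e(m) = (V + i m)/√(V² + m²)` is unit, smooth and injective with `Re e > 0`,
`V Im e/Re e = m` (`ModelHandles.dir_props`), and a chart `h` with `z(h p) = z₀ + r s d e(m)`, `w(h p) = r w̃`
is conical about `(z₀, 0)`: `‖h p - (z₀, 0)‖ = r` (`ModelHandles.chart_dist`). [folklore] -/
theorem helper_handlebodyChart_modelHandles_polarChart : (∀ (V : ℝ), 0 < V → ∀ (e : ℝ → ℂ), (∀ m, e m = ((V : ℂ) + (m : ℂ) * Complex.I) * (((Real.sqrt (V ^ 2 + m ^ 2))⁻¹ : ℝ) : ℂ)) → (∀ m, ‖e m‖ = 1) ∧ (∀ m, 0 < (e m).re) ∧ (∀ m, V * (e m).im / (e m).re = m) ∧ ContDiff ℝ ((⊤ : ℕ∞) : WithTop ℕ∞) e ∧ Function.Injective e) ∧ (∀ (h : EuclideanSpace ℝ (Fin 4) → EuclideanSpace ℝ (Fin 4)) (fr fm : ℝ → ℝ → ℝ) (z₀ d : ℂ) (N : ℝ) (e : ℝ → ℂ), ‖d‖ = 1 → (∀ m, ‖e m‖ = 1) → 0 < N → (∀ p, Literature.AlgebraicTopology.Homotopy.HopfFibration.zC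 (h p) = z₀ + ((fr (p 0) (p 1) * Real.sqrt (1 - ((p 2) ^ 2 + (p 3) ^ 2) / N ^ 2) : ℝ) : ℂ) * d * e (fm (p 0) (p 1))) → (∀ p, Literature.AlgebraicTopology.Homotopy.HopfFibration.wC (h p) = ((fr (p 0) (p 1) / N : ℝ) : ℂ) * ((p 2 : ℂ) + (p 3 : ℂ) * Complex.I)) → ∀ p, 0 ≤ fr (p 0) (p 1) → (p 2) ^ 2 + (p 3) ^ 2 ≤ N ^ 2 → ‖h p - Literature.AlgebraicTopology.Homotopy.HopfFibration.ofZW z₀ 0‖ = fr (p 0) (p 1)) :=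
  ⟨fun _ hV e hE => by
    obtain ⟨h1, -, h3, h4, h5, h6⟩ := ModelHandles.dir_props hV e hE
    exact ⟨h1, h3, h4, h5, h6⟩,
   fun _ _ _ _ _ _ _ hd he hN hz hw _ hr hp => ModelHandles.chart_dist hd he hN hz hw hr hp⟩

end Summit.SmoothPoincare4.SmoothPoincare4.Theorems.DcrGap.MkFriends

end
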